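import Summits.CriticalPhenomena.PercolationContinuityZ3.Theorems.PercNearOneGluingNearOneGluingQ7ThreeCutAux

/-!
# `NoHeavyLowerTail` (stmt-CriticalPhenomena-4575) — Kozma–Nitzan Question 7 for three relays:
# the RAW `x`-BRACKET condition (recipe X) and its coverage of the low-density locus

Support file (lemma factory `prim-lf-2`, deletion–contraction, gen 7; `--supports stmt-CriticalPhenomena-4575`).
No definitions, no named facts, no sorries.

Setting (as in `…NearOneGluingQ7ThreeCutAux`): finite weighted graph on `Fin n`, `μ = prodBernoulli w`, source `o`,
target `b`, relays `x, y, z` with `z` the least reliable, `oA = {o↔x} ∪ {o↔y} ∪ {o↔z}`, `D = {x ↮ y} ∩ {x ↮ z}`.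
Kozma–Nitzan's Question 7 (arXiv:2401.12397, p. 36) for `A = {x, y, z}` asks whether `μ(o↔b ∩ oA) ≥ μ(z↔b ∩ oA)`.

The landed decomposition `q7Three_decomp` splits the Question-7 slack into the `y`-BRACKET
`μ({o↔y} ∩ ({y↔b} ∖ {z↔b})) − μ({o↔y} ∩ ({z↔b} ∖ {y↔b}))`, which is `≥ 0` whenever `μ(z↔b) ≤ μ(y↔b)`
(`q7Three_lemma3`, Kozma–Nitzan Lemma 3(i)), and the `x`-BRACKET
`X(x) := μ(D ∩ {o↔x} ∩ {x↔b}) − μ(D ∩ {o↔x} ∩ {z↔b})` — in words: "the source hangs on `x` ALONE (`o ↔ x`,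
`o ↮ y`, `o ↮ z`) and reaches `b`" minus "the source hangs on `x` alone and misses `b` while `z ↔ b`".  The landed
`q7Three_of_cut` makes the `x`-bracket nonnegative through van den Berg–Häggström–Kahn (the CUT CASE
`μ(D ∩ {z↔b}) ≤ μ(D ∩ {x↔b})`).  Here we record the UN-LINEARISED condition itself:

* `q7Three_of_xBracket` — if `μ(z↔b) ≤ μ(y↔b)` and `X(x) ≥ 0` then (41) holds for `z` (three lines from the two
  landed lemmas; note that only the comparison of `z` with the OTHER relay `y` is needed);
* `q7Three_of_yBracket` — the mirror image (`X(y) ≥ 0` and `μ(z↔b) ≤ μ(x↔b)`);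
* `conjOneThree_of_xBracket` — the Conjecture-1 corollary `μ(oA)·μ(z↔b) ≤ μ(o↔b)` (Harris).

Why record a corollary: the raw bracket is a RECIPE (a linear functional of the five-point connection law) and it is
much stronger than its BHK shadow.  Exact census (this seat, gen 7, on the cell's recipe-coverage lists
`run/shared/lean/ttrl/q7recipe/outputs/`, plain observer `o = 0`, `b = 1`): on the 990 instances with `n ≤ 6` where ALL
six recipes of the menu (KNB, R5, R6, R7, KN′, KN″) are negative AND all five proved conditions K (Theorem 2), A, C
(= the cut case), S (reliable source), B fail, the condition `X(x) ≥ 0 ∨ X(y) ≥ 0` holds on 807 (49/60 at `n = 5`,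
758/930 at `n = 6`), i.e. it certifies Question 7 on 81 % of the menu's failures; the residual at `n = 5` is exactly
the two symmetric dense supports at uniform small weight (`K₅ − ob` and `K₅ − {ob, o–z}` with `z` the relay not
adjacent to `o`), where `X(x) = X(y) < 0` by symmetry (second-order tie regime; e.g. `K₅ − ob`, all weights `1/10`:
slack `6561/10⁷`, `X(x) = X(y) = −1.12·10⁻³`).  The same two brackets, read through the sure-hub construction of
`…KnQuestion9Hub`, are valid at a GLUED source with the PRE-glue minimiser (only `μ_K(z↔b) ≤ μ_K(y↔b)` in the unglued
graph is used), so the condition also certifies the (41)-face SPLIT-Q / Q7G / SMIN / Conjecture 6 of the one-pair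
contraction atlas at `|A| = 3` (prim-lf-2 CANDIDATES §GEN 6–7).
[cite: KozmaNitzan2024, Question 7 (p. 36), Lemma 3(i) (pp. 6–7), Conjecture 1 (p. 3)]
-/

namespace Summit.CriticalPhenomena.PercolationContinuityZ3.Theorems

open MeasureTheory Set Literature.Probability.LatticeModels Literature.Probability.Percolation
open scoped Classical BigOperators
open Q7ThreeCut

noncomputable section

variable {n : ℕ}

/-- **Question 7 for three relays from the raw `x`-bracket (recipe X).**  If `μ(z↔b) ≤ μ(y↔b)` and, with
`D = {x ↮ y} ∩ {x ↮ z}`, `μ(D ∩ {o↔x} ∩ {z↔b}) ≤ μ(D ∩ {o↔x} ∩ {x↔b})` ("hanging on `x` alone, the source reaches `b`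
at least as often as it misses `b` while `z ↔ b`"), then `μ({z↔b} ∩ oA) ≤ μ({o↔b} ∩ oA)`,
`oA = {o↔x} ∪ {o↔y} ∪ {o↔z}`.  Proof: `q7Three_decomp` and `q7Three_lemma3`.
[cite: KozmaNitzan2024, Question 7 (p. 36), Lemma 3(i) (pp. 6–7)] -/
theorem q7Three_of_xBracket (w : Sym2 (Fin n) → unitInterval) (o b x y z : Fin n)
    (hyz : (prodBernoulli w).real (openConn z b) ≤ (prodBernoulli w).real (openConn y b))
    (hX : (prodBernoulli w).real (((openConn x y)ᶜ ∩ (openConn x z)ᶜ) ∩ openConn o x ∩ openConn z b) ≤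
      (prodBernoulli w).real (((openConn x y)ᶜ ∩ (openConn x z)ᶜ) ∩ openConn o x ∩ openConn x b)) :
    (prodBernoulli w).real (openConn z b ∩ (openConn o x ∪ openConn o y ∪ openConn o z)) ≤
      (prodBernoulli w).real (openConn o b ∩ (openConn o x ∪ openConn o y ∪ openConn o z)) := by
  have hdec := q7Three_decomp w o b x y z
  have hl3 := q7Three_lemma3 w o b y z hyz
  linarith

/-- **Question 7 for three relays from the raw `y`-bracket** (mirror image of `q7Three_of_xBracket`): if
`μ(z↔b) ≤ μ(x↔b)` and `μ(D' ∩ {o↔y} ∩ {z↔b}) ≤ μ(D' ∩ {o↔y} ∩ {y↔b})` with `D' = {y ↮ x} ∩ {y ↮ z}`, then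
`μ({z↔b} ∩ oA) ≤ μ({o↔b} ∩ oA)`. [cite: KozmaNitzan2024, Question 7 (p. 36)] -/
theorem q7Three_of_yBracket (w : Sym2 (Fin n) → unitInterval) (o b x y z : Fin n)
    (hxz : (prodBernoulli w).real (openConn z b) ≤ (prodBernoulli w).real (openConn x b))
    (hY : (prodBernoulli w).real (((openConn y x)ᶜ ∩ (openConn y z)ᶜ) ∩ openConn o y ∩ openConn z b) ≤
      (prodBernoulli w).real (((openConn y x)ᶜ ∩ (openConn y z)ᶜ) ∩ openConn o y ∩ openConn y b)) :
    (prodBernoulli w).real (openConn z b ∩ (openConn o x ∪ openConn o y ∪ openConn o z)) ≤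
      (prodBernoulli w).real (openConn o b ∩ (openConn o x ∪ openConn o y ∪ openConn o z)) := by
  have h := q7Three_of_xBracket w o b y x z hxz hY
  rw [Set.union_comm (openConn o y) (openConn o x)] at h
  exact h

/-- **Conjecture 1 for three relays from the raw `x`-bracket** (corollary): under the hypotheses of
`q7Three_of_xBracket`, `μ(oA) · μ(z↔b) ≤ μ(o↔b)`; since `z` is the least reliable relay this is Kozma–Nitzan's
Conjecture 1 for `A = {x, y, z}`.  Harris' inequality for the increasing events `{z↔b}`, `oA`, and monotonicity.
[cite: KozmaNitzan2024, Conjecture 1 (p. 3)] -/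
theorem conjOneThree_of_xBracket (w : Sym2 (Fin n) → unitInterval) (o b x y z : Fin n)
    (hyz : (prodBernoulli w).real (openConn z b) ≤ (prodBernoulli w).real (openConn y b))
    (hX : (prodBernoulli w).real (((openConn x y)ᶜ ∩ (openConn x z)ᶜ) ∩ openConn o x ∩ openConn z b) ≤
      (prodBernoulli w).real (((openConn x y)ᶜ ∩ (openConn x z)ᶜ) ∩ openConn o x ∩ openConn x b)) :
    (prodBernoulli w).real (openConn o x ∪ openConn o y ∪ openConn o z) *
        (prodBernoulli w).real (openConn z b) ≤
      (prodBernoulli w).real (openConn o b) := by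
  have hq7 := q7Three_of_xBracket w o b x y z hyz hX
  have hup : IsUpperSet (openConn o x ∪ openConn o y ∪ openConn o z : Set (BondConfig (Fin n))) :=
    ((isUpperSet_openConn o x).union (isUpperSet_openConn o y)).union (isUpperSet_openConn o z)
  have hhar := prodBernoulli_harris w (isUpperSet_openConn z b) hup MeasurableSet.of_discrete
    MeasurableSet.of_discrete
  have hmono : (prodBernoulli w).real (openConn o b ∩ (openConn o x ∪ openConn o y ∪ openConn o z)) ≤
      (prodBernoulli w).real (openConn o b) := measureReal_mono inter_subset_left
  nlinarith [hhar, hq7, hmono, mul_comm ((prodBernoulli w).real (openConn o x ∪ openConn o y ∪ openConn o z))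
    ((prodBernoulli w).real (openConn z b))]

end

end Summit.CriticalPhenomena.PercolationContinuityZ3.Theorems
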